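import Literature.NumberTheory.Transcendental.BallRivoalLinearForms
import Mathlib.Tactic
import HarnessLib

/-!
# Partial-fraction bookkeeping for transfer arguments (cell `pub-zeta5`, P1)

HONEST FRAMING: systematic search; no irrationality claim unless certified.

Small generic lemmas over `BallRivoal.pfEval` (data `c o p` = coefficient of `1/(t+p+1)^{o+1}`): zero-padding of the
pole range (`padData`), the shift `t ↦ t+1` as a shift of the pole index (`shiftUp`), evaluation of linear
combinations (`pfEval_comb`), and "data evaluating to `0` at all naturals have vanishing coefficient sums"
(`sum_eq_zero_of_pfEval_zero`, from `BallRivoal.pf_unique`); plus two Pochhammer identities. Used by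
`WedgeDictionaryCornerTransfer.lean` to move creative-telescoping identities between rational functions to their
fixed-order coefficient sums (the canonical `ζ(5)`/`ζ(3)`-coefficients `U, W` of the wedge dictionary).
-/

noncomputable section

open Finset

namespace Summit.KontsevichZagierPeriods.Zeta5Search.WedgeDictionary

open Literature.NumberTheory.Transcendental
open Literature.NumberTheory.Transcendental.BallRivoal (pfEval pf_unique)

/-! ### Generic bookkeeping for partial-fraction data -/

/-- Zero-padding of data beyond the pole index `N`. -/
def padData (N : ℕ) (c : ℕ → ℕ → ℚ) : ℕ → ℕ → ℚ := fun o p => if p ≤ N then c o p else 0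

/-- Data of `F(t+1)` from data of `F(t)`: shift the pole index up by one. -/
def shiftUp (c : ℕ → ℕ → ℚ) : ℕ → ℕ → ℚ := fun o p => if p = 0 then 0 else c o (p - 1)

/-- Padding does not change the evaluation. -/
theorem pfEval_padData {N M : ℕ} (h : N ≤ M) (K : ℕ) (c : ℕ → ℕ → ℚ) (t : ℚ) :
    pfEval M K (padData N c) t = pfEval N K c t := by
  unfold pfEval
  have hsub : range (N + 1) ⊆ range (M + 1) := range_subset_range.2 (by omega)
  rw [← sum_subset hsub]
  · refine sum_congr rfl fun p hp => sum_congr rfl fun o _ => ?_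
    rw [padData, if_pos (Nat.lt_succ_iff.1 (mem_range.1 hp))]
  · intro p _ hp
    have hp' : ¬ p ≤ N := fun h' => hp (mem_range.2 (Nat.lt_succ_of_le h'))
    exact sum_eq_zero fun o _ => by rw [padData, if_neg hp', zero_div]

/-- Shifting the pole index realises `t ↦ t + 1`. -/
theorem pfEval_shiftUp (N K : ℕ) (c : ℕ → ℕ → ℚ) (t : ℚ) :
    pfEval (N + 1) K (shiftUp c) t = pfEval N K c (t + 1) := by
  unfold pfEval
  rw [sum_range_succ']
  have h0 : ∑ o ∈ range K, shiftUp c o 0 / (t + ((0 : ℕ) : ℚ) + 1) ^ (o + 1) = 0 :=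
    sum_eq_zero fun o _ => by simp [shiftUp]
  rw [h0, add_zero]
  refine sum_congr rfl fun p _ => sum_congr rfl fun o _ => ?_
  simp only [shiftUp, Nat.add_one_ne_zero, if_false, Nat.add_sub_cancel]
  push_cast
  ring

/-- `pfEval` of the five-term combinations used below. -/
theorem pfEval_comb (N K : ℕ) (a0 a1 a2 : ℚ) (c0 c1 c2 d e : ℕ → ℕ → ℚ) (t : ℚ) :
    pfEval N K (fun o p => a0 * c0 o p + a1 * c1 o p + a2 * c2 o p + d o p - e o p) t =
      a0 * pfEval N K c0 t + a1 * pfEval N K c1 t + a2 * pfEval N K c2 t + pfEval N K d t - pfEval N K e t := by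
  unfold pfEval
  simp only [add_div, sub_div, mul_div_assoc, sum_add_distrib, sum_sub_distrib, mul_sum]

/-- Data evaluating to `0` at every natural `t` have vanishing order-`o` coefficient sums. -/
theorem sum_eq_zero_of_pfEval_zero (N K : ℕ) (e : ℕ → ℕ → ℚ) (h : ∀ t : ℕ, pfEval N K e t = 0) {o : ℕ}
    (ho : o < K) : ∑ p ∈ range (N + 1), e o p = 0 :=
  sum_eq_zero fun p hp => pf_unique N K e 0 (fun t _ => h t) o p ho (Nat.lt_succ_iff.1 (mem_range.1 hp))

/-- Coefficient sums of padded data. -/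
theorem sum_padData {N M : ℕ} (h : N ≤ M) (c : ℕ → ℕ → ℚ) (o : ℕ) :
    ∑ p ∈ range (M + 1), padData N c o p = ∑ p ∈ range (N + 1), c o p := by
  have hsub : range (N + 1) ⊆ range (M + 1) := range_subset_range.2 (by omega)
  rw [← sum_subset hsub]
  · exact sum_congr rfl fun p hp => by rw [padData, if_pos (Nat.lt_succ_iff.1 (mem_range.1 hp))]
  · intro p _ hp
    have hp' : ¬ p ≤ N := fun h' => hp (mem_range.2 (Nat.lt_succ_of_le h'))
    rw [padData, if_neg hp']

/-- Coefficient sums of shifted data. -/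
theorem sum_shiftUp (N : ℕ) (c : ℕ → ℕ → ℚ) (o : ℕ) :
    ∑ p ∈ range (N + 2), shiftUp c o p = ∑ p ∈ range (N + 1), c o p := by
  rw [sum_range_succ']
  simp [shiftUp]

/-! ### Pochhammer bookkeeping -/

/-- `(t)_{k+1} = (t)_k (t+k)`. -/
theorem poch_succ_right (t : ℚ) (k : ℕ) : BallRivoal.poch t (k + 1) = BallRivoal.poch t k * (t + k) := by
  rw [BallRivoal.poch, BallRivoal.poch, prod_range_succ]

/-- `(t)_{k+1} = t (t+1)_k`. -/
theorem poch_succ_left (t : ℚ) (k : ℕ) : BallRivoal.poch t (k + 1) = t * BallRivoal.poch (t + 1) k := by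
  rw [BallRivoal.poch, BallRivoal.poch, prod_range_succ']
  simp only [Nat.cast_zero, add_zero, Nat.cast_succ, mul_comm]
  congr 1
  exact prod_congr rfl fun s _ => by ring

end Summit.KontsevichZagierPeriods.Zeta5Search.WedgeDictionary
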